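import Summits.ResolutionOfSingularities.ResolutionOfSingularities.Theorems.PurelyInseparableDim4ChartChainStep
import HarnessLib

/-!
# Purely inseparable four-folds `z^p + F(x₁, …, x₄)`: CLOSEDNESS = INTEGRALITY — the walk's next coordinate
# centre, read on a chart of ANY depth, is closed in the blown-up ambient iff the composite chart
# substitution makes `K[z, x]/(z, x_{S'})` an INTEGRAL extension (brick TY-2 g3 (a1) of cell `res-dim4-pi`)

[OURS · counted 0] (D-0157 DOOR 2; director-resolution DR-157-C; desk WORD #66 (4); frame
`PIDim4.TerminationImpliesOrderReduction`, S3 (c) coordinate regime). The files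
`PurelyInseparableDim4ChartCentreClosed/Escape.lean` (typ-2 g2) decided closedness of the walk's next centre
`V(z, x_{S'})` at DEPTH ONE (`S.erase j ⊆ S'`, twisted generators / valuative criterion) and
`PurelyInseparableDim4ChartChainStep.lean` propagated it along steps `S' ⊆ S''`; at depth `≥ 3` a step
`S'.erase j' ⊆ S'' ∌ j'` is closed or not depending on the HISTORY (fibre directions and translations of all
earlier blow-ups). This file isolates WHAT the history is and HOW it decides: PROVED here (no `sorry`, no new
axiom) —

* §1 **`isClosed_image_zeroLocus_iff_isIntegral`** (any universe; pure Mathlib): for a separated, universally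
  closed `ρ : W ⟶ Spec A` (e.g. any tower of blowings up of `𝔸ⁿ⁺¹`), an open-immersion chart `φ : Spec B ⟶ W`
  with `φ ≫ ρ = Spec Ψ`, and an ideal `I ⊆ B`: the chart image `φ(V(I))` is CLOSED in `W` iff
  `A → B → B/I` is an INTEGRAL ring map. (⇒: a preimmersion with closed range is a closed immersion,
  hence `Spec (B/I) → W → Spec A` is universally closed and affine, i.e. integral —
  `IsIntegralHom.iff_universallyClosed_and_isAffineHom`; ⇐: `IsIntegralHom.of_comp` with `ρ` separated, and an
  integral morphism has closed range.) `isClosed_image_zeroLocus_of_surjective`: SURJECTIVE suffices.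
* §2 the coordinate form for `𝔸ⁿ⁺¹_K`: **`isClosed_image_CΛ_iff_isIntegral`** /
  `isClosed_image_CΛ_of_surjective` — `φ(V(x_Λ))` is closed in `W` iff
  `K[x] —Ψ→ K[x] → K[x]/(x_Λ)` is integral; in particular if it is onto.
* §3 **the history is the composite substitution**: `chart_comp_eq_specMap` — the re-centred chart
  `Spec Θ ≫ chartImm_j` of a blowing up `π` of `𝔸ⁿ⁺¹` along `V(x_Λ)` has `(Spec Θ ≫ chartImm_j) ≫ π = Spec (Θ ∘ ψ_j)`
  (`ψ_j = coordBlowupSubst K Λ j`); `chart_of_chart_comp_eq_specMap` — if `φ ≫ ρ = Spec Ψ` then the chart of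
  the chart `φ'' = Spec Θ' ≫ chartImm_{j'} ≫ (π₂⁻¹ φ(𝔸⁵) ↪ W₂)` of a blowing up `π₂` of the global centre has
  `φ'' ≫ (π₂ ≫ ρ) = Spec (Θ' ∘ ψ_{j'} ∘ Ψ)`. So along ANY branch of the walk the pair
  (ambient `ρ_n : W_n ⟶ 𝔸⁵`, chart `φ_n`) carries an explicit `Ψ_n = Θ_n ψ_{j_n} ⋯ Θ₁ ψ_{j₁}`, and
  **`isClosed_image_CΛ_chart_iff_isIntegral`** (depth one, any `n`, `Λ`, `Θ`) /
  **`isClosed_image_CΛ_chart_of_chart_iff`** (chart of a chart) — the next centre `V(z, x_{S''})` read on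
  `φ''` is closed in `W₂` iff `K[x_k : k ∉ S'']` is integral over the residues of
  `Θ'ψ_{j'}Ψ (z), Θ'ψ_{j'}Ψ (xᵢ)`: a finite computation in `K[z, x]`, uniform in the depth (the depth-3
  evaluation is the sequel file `PurelyInseparableDim4ChartChainHistory.lean`).

Nothing here is a statement about resolution of singularities in dimension ≥ 4 / characteristic `p` (NOT
proved anywhere in this programme). bears_on: LADDER-RESOLUTION:D157-DOOR2 (res-dim4-pi). Supports
stmt-ResolutionOfSingularities-16155 (helper, TY-2 g3 (a1)).
-/

-- every declaration of this summit lives under `Summit.ResolutionOfSingularities.ResolutionOfSingularities`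
-- (summit = problem), which the duplicate-namespace linter flags; house convention (cf. the Target file).
set_option linter.dupNamespace false

noncomputable section

open MvPolynomial Finset CategoryTheory AlgebraicGeometry Opposite TopologicalSpace
open AlgebraicGeometry.Scheme.IdealSheafData (ofIdealTop vanishingIdeal)

namespace Summit.ResolutionOfSingularities.ResolutionOfSingularities.Theorems.PIDim4

open Literature.AlgebraicGeometry.Resolution
open Literature.AlgebraicGeometry.Resolution.AffinePointBlowup (P A γ coord Wtop)

namespace ChartDictionary

/-! ## §1 Closedness of a chart image = integrality (general schemes) -/

section General

universe u

variable {A B : CommRingCat.{u}} {W : Scheme.{u}}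

/-- The range of `Spec (B/I) → Spec B` is the zero locus `V(I)`. -/
theorem range_specMap_quotient_mk (I : Ideal B) :
    Set.range (Spec.map (CommRingCat.ofHom (Ideal.Quotient.mk I))) =
      PrimeSpectrum.zeroLocus ((I : Ideal B) : Set B) := by
  have hr : Set.range (PrimeSpectrum.comap (Ideal.Quotient.mk I)) =
      PrimeSpectrum.zeroLocus ((I : Ideal B) : Set B) := by
    rw [range_comap_of_surjective _ _ Ideal.Quotient.mk_surjective, Ideal.mk_ker]
  ext x
  constructor
  · rintro ⟨y, rfl⟩
    have hy : PrimeSpectrum.comap (Ideal.Quotient.mk I) y ∈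
        Set.range (PrimeSpectrum.comap (Ideal.Quotient.mk I)) := ⟨y, rfl⟩
    rw [hr] at hy
    exact hy
  · intro hx
    have hx' : (x : PrimeSpectrum B) ∈ Set.range (PrimeSpectrum.comap (Ideal.Quotient.mk I)) := by
      rw [hr]
      exact hx
    obtain ⟨y, hy⟩ := hx'
    exact ⟨y, hy⟩

/-- **CLOSEDNESS = INTEGRALITY.** Let `ρ : W ⟶ Spec A` be separated and universally closed (e.g. a tower of
blowings up), `φ : Spec B ⟶ W` an open immersion (a chart) with `φ ≫ ρ = Spec Ψ`, and `I` an ideal of `B`.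
Then the chart image `φ(V(I))` is CLOSED in `W` iff the ring map `A —Ψ→ B → B/I` is INTEGRAL
(equivalently: `V(I) → Spec A` is finite onto its image; equivalently `V(I) ↪ W` is a closed immersion). -/
theorem isClosed_image_zeroLocus_iff_isIntegral (φ : Spec B ⟶ W) [IsOpenImmersion φ] (ρ : W ⟶ Spec A)
    [IsSeparated ρ] [UniversallyClosed ρ] {Ψ : A ⟶ B} (hc : φ ≫ ρ = Spec.map Ψ) (I : Ideal B) :
    IsClosed (φ '' PrimeSpectrum.zeroLocus ((I : Ideal B) : Set B)) ↔
      ((Ideal.Quotient.mk I).comp Ψ.hom).IsIntegral := by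
  set ι : Spec (CommRingCat.of (B ⧸ I)) ⟶ Spec B := Spec.map (CommRingCat.ofHom (Ideal.Quotient.mk I))
    with hι
  have hcomp : (ι ≫ φ) ≫ ρ = Spec.map (CommRingCat.ofHom ((Ideal.Quotient.mk I).comp Ψ.hom)) := by
    rw [Category.assoc, hc, hι, ← Spec.map_comp]
    rfl
  have himage : φ '' PrimeSpectrum.zeroLocus ((I : Ideal B) : Set B) =
      Set.range (fun x => (ι ≫ φ) x) := by
    rw [← range_specMap_quotient_mk I, ← Set.range_comp]
    congr 1
  rw [himage]
  constructor
  · intro hcl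
    haveI : IsClosedImmersion (ι ≫ φ) := IsClosedImmersion.of_isPreimmersion _ hcl
    have h1 : UniversallyClosed ((ι ≫ φ) ≫ ρ) :=
      MorphismProperty.IsStableUnderComposition.comp_mem _ _ inferInstance inferInstance
    have h2 : IsIntegralHom ((ι ≫ φ) ≫ ρ) := by
      refine IsIntegralHom.iff_universallyClosed_and_isAffineHom.mpr ⟨h1, ?_⟩
      rw [hcomp]
      infer_instance
    rw [hcomp] at h2
    exact IsIntegralHom.SpecMap_iff.mp h2
  · intro hint
    haveI : IsIntegralHom ((ι ≫ φ) ≫ ρ) := by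
      rw [hcomp]
      exact IsIntegralHom.SpecMap_iff.mpr hint
    haveI : IsIntegralHom (ι ≫ φ) := IsIntegralHom.of_comp _ ρ
    exact (ι ≫ φ).isClosedMap.isClosed_range

/-- **Surjective suffices**: if `A —Ψ→ B → B/I` is onto (the chart functions on `V(I)` are polynomials in
the pulled-back base coordinates), the chart image `φ(V(I))` is closed in `W`. -/
theorem isClosed_image_zeroLocus_of_surjective (φ : Spec B ⟶ W) [IsOpenImmersion φ] (ρ : W ⟶ Spec A)
    [IsSeparated ρ] [UniversallyClosed ρ] {Ψ : A ⟶ B} (hc : φ ≫ ρ = Spec.map Ψ) (I : Ideal B)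
    (hsurj : Function.Surjective ((Ideal.Quotient.mk I).comp Ψ.hom)) :
    IsClosed (φ '' PrimeSpectrum.zeroLocus ((I : Ideal B) : Set B)) :=
  (isClosed_image_zeroLocus_iff_isIntegral φ ρ hc I).mpr (RingHom.isIntegral_of_surjective _ hsurj)

end General

/-! ## §2 The coordinate form on `𝔸ⁿ⁺¹_K` -/

section Affine

variable {n : ℕ} {K : Type} [Field K] {W : Scheme.{0}} (φ : P n K ⟶ W) [IsOpenImmersion φ]
  (ρ : W ⟶ P n K) [IsSeparated ρ] [UniversallyClosed ρ] {Ψ : A n K →+* A n K}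

/-- **Coordinate centres.** For a separated universally closed `ρ : W ⟶ 𝔸ⁿ⁺¹_K`, an open-immersion chart
`φ : 𝔸ⁿ⁺¹_K ⟶ W` with `φ ≫ ρ = Spec Ψ` and a set of coordinates `Λ`: the chart image `φ(V(x_Λ))` is CLOSED
in `W` iff `K[x] —Ψ→ K[x] → K[x]/(x_Λ)` is an integral ring map. -/
theorem isClosed_image_CΛ_iff_isIntegral (hc : φ ≫ ρ = Spec.map (CommRingCat.ofHom Ψ))
    (Λ : Set (Fin (n + 1))) :
    IsClosed (φ '' (AffineCoordBlowup.CΛ n K Λ : Set (P n K))) ↔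
      ((Ideal.Quotient.mk (AffineCoordBlowup.IΛ n K Λ)).comp Ψ).IsIntegral :=
  isClosed_image_zeroLocus_iff_isIntegral φ ρ hc (AffineCoordBlowup.IΛ n K Λ)

/-- **Coordinate centres, surjective form.** If `K[x] —Ψ→ K[x] → K[x]/(x_Λ)` is onto, `φ(V(x_Λ))` is closed
in `W`. -/
theorem isClosed_image_CΛ_of_surjective (hc : φ ≫ ρ = Spec.map (CommRingCat.ofHom Ψ))
    (Λ : Set (Fin (n + 1)))
    (hsurj : Function.Surjective ((Ideal.Quotient.mk (AffineCoordBlowup.IΛ n K Λ)).comp Ψ)) :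
    IsClosed (φ '' (AffineCoordBlowup.CΛ n K Λ : Set (P n K))) :=
  isClosed_image_zeroLocus_of_surjective φ ρ hc (AffineCoordBlowup.IΛ n K Λ) hsurj

/-- **Coordinate centres, escape form.** If `K[x] —Ψ→ K[x] → K[x]/(x_Λ)` is NOT integral, `φ(V(x_Λ))` is
not closed in `W`. -/
theorem not_isClosed_image_CΛ_of_not_isIntegral (hc : φ ≫ ρ = Spec.map (CommRingCat.ofHom Ψ))
    (Λ : Set (Fin (n + 1)))
    (hint : ¬ ((Ideal.Quotient.mk (AffineCoordBlowup.IΛ n K Λ)).comp Ψ).IsIntegral) :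
    ¬ IsClosed (φ '' (AffineCoordBlowup.CΛ n K Λ : Set (P n K))) :=
  fun h => hint ((isClosed_image_CΛ_iff_isIntegral φ ρ hc Λ).mp h)

end Affine

/-! ## §3 The history is the composite chart substitution -/

section History

variable {n : ℕ} {K : Type} [Field K]

/-- **Depth one.** The re-centred chart `Spec Θ ≫ chartImm_i` of a blowing up `π : W → 𝔸ⁿ⁺¹_K` along
`V(x_Λ)` (`i ∈ Λ`, `Θ` any ring endomorphism of `K[x]`) satisfies `(Spec Θ ≫ chartImm_i) ≫ π = Spec (Θ ∘ ψ_i)`,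
`ψ_i = coordBlowupSubst K Λ i`. -/
theorem chart_comp_eq_specMap {Λ : Set (Fin (n + 1))} {W : Scheme.{0}} {π : W ⟶ P n K}
    (hπ : IsBlowup π (AffineCoordBlowup.𝓘Λ n K Λ)) {i : Fin (n + 1)} (hi : i ∈ Λ) (Θ : A n K →+* A n K) :
    (Spec.map (CommRingCat.ofHom Θ) ≫ AffineCoordBlowup.chartImm hπ hi) ≫ π =
      Spec.map (CommRingCat.ofHom (Θ.comp (coordBlowupSubst K Λ i).toRingHom)) := by
  rw [Category.assoc, AffineCoordBlowup.chartImm_comp hπ hi, ← Spec.map_comp]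
  rfl

/-- **THE HISTORY CRITERION, depth one** (any `n`, any centre `V(x_Λ)`, any chart `i ∈ Λ`, any re-centring
automorphism `Θ` of `K[x]`, any next centre `V(x_{Λ''})`): the image of `V(x_{Λ''})` under the re-centred chart
`Spec Θ ≫ chartImm_i` is CLOSED in the blow-up `W` iff `K[x] → K[x]/(x_{Λ''})` precomposed with `Θ ∘ ψ_i` is an
integral ring map. (For `n = 4`, `Λ = {z} ∪ x_S`, `Λ'' = {z} ∪ x_{S'}` and a translation-cleaning `Θ` this is
decided in `PurelyInseparableDim4ChartCentreEscape.lean`: iff `S.erase j ⊆ S'`.) -/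
theorem isClosed_image_CΛ_chart_iff_isIntegral {Λ : Set (Fin (n + 1))} {W : Scheme.{0}} {π : W ⟶ P n K}
    (hπ : IsBlowup π (AffineCoordBlowup.𝓘Λ n K Λ)) {i : Fin (n + 1)} (hi : i ∈ Λ) (Θ : A n K →+* A n K)
    [IsIso (CommRingCat.ofHom Θ)] (Λ'' : Set (Fin (n + 1))) :
    IsClosed ((Spec.map (CommRingCat.ofHom Θ) ≫ AffineCoordBlowup.chartImm hπ hi) ''
      (AffineCoordBlowup.CΛ n K Λ'' : Set (P n K))) ↔
      ((Ideal.Quotient.mk (AffineCoordBlowup.IΛ n K Λ'')).comp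
        (Θ.comp (coordBlowupSubst K Λ i).toRingHom)).IsIntegral := by
  haveI : IsProper π := hπ.isProper
  exact isClosed_image_CΛ_iff_isIntegral _ π (chart_comp_eq_specMap hπ hi Θ) Λ''

variable {Z W₂ : Scheme.{0}} (φ : P 4 K ⟶ Z) [IsOpenImmersion φ] {π₂ : W₂ ⟶ Z}

/-- **Chart of a chart.** If the chart `φ : 𝔸⁵_K ⟶ Z` has `φ ≫ ρ = Spec Ψ` over `ρ : Z ⟶ 𝔸⁵_K`, `π₂ : W₂ → Z` is
a blowing up of the global centre `Z_c = 𝓘(closure φ(V(x_Λ')))`, `j' ∈ Λ'` and `Θ'` is any ring endomorphism of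
`K[z, x]`, then the chart of the chart `φ'' = Spec Θ' ≫ chartImm_{j'} ≫ (π₂⁻¹ φ(𝔸⁵) ↪ W₂)` satisfies
`φ'' ≫ (π₂ ≫ ρ) = Spec (Θ' ∘ ψ_{j'} ∘ Ψ)`: the history of the branch is the composite substitution. -/
theorem chart_of_chart_comp_eq_specMap {ρ : Z ⟶ P 4 K} {Ψ : A 4 K →+* A 4 K}
    (hc : φ ≫ ρ = Spec.map (CommRingCat.ofHom Ψ)) {Λ' : Set (Fin (4 + 1))}
    (hπ₂ : IsBlowup π₂ (vanishingIdeal (closureImage φ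
      ((AffineCoordBlowup.𝓘Λ 4 K Λ').support : Set (P 4 K))))) {j' : Fin (4 + 1)} (hj' : j' ∈ Λ')
    (Θ' : A 4 K →+* A 4 K) :
    (Spec.map (CommRingCat.ofHom Θ') ≫
        AffineCoordBlowup.chartImm (isBlowup_restrict_globalCentre φ _ hπ₂) hj' ≫ (π₂ ⁻¹ᵁ φ.opensRange).ι) ≫
      π₂ ≫ ρ =
      Spec.map (CommRingCat.ofHom ((Θ'.comp (coordBlowupSubst K Λ' j').toRingHom).comp Ψ)) := by
  have hι : φ.isoOpensRange.symm.hom ≫ φ = φ.opensRange.ι := by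
    rw [Iso.symm_hom, Iso.inv_comp_eq, Scheme.Hom.isoOpensRange_hom_ι]
  have h1 : (π₂ ⁻¹ᵁ φ.opensRange).ι ≫ π₂ ≫ ρ =
      ((π₂ ∣_ φ.opensRange) ≫ φ.isoOpensRange.symm.hom) ≫ Spec.map (CommRingCat.ofHom Ψ) := by
    rw [← hc, Category.assoc, reassoc_of% hι, morphismRestrict_ι_assoc]
  rw [Category.assoc, Category.assoc, h1, ← Category.assoc (AffineCoordBlowup.chartImm _ hj'),
    AffineCoordBlowup.chartImm_comp (isBlowup_restrict_globalCentre φ _ hπ₂) hj', ← Spec.map_comp,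
    ← Spec.map_comp]
  rfl

/-- **THE HISTORY CRITERION (chart of a chart).** In the situation of `chart_of_chart_comp_eq_specMap` with
`ρ` separated and universally closed (any tower of blowings up of `𝔸⁵_K`): the next centre `V(x_{Λ''})` read
on the chart of the chart `φ''` is CLOSED in `W₂` iff `K[z, x] → K[z, x]/(x_{Λ''})` precomposed with the
composite substitution `Θ' ∘ ψ_{j'} ∘ Ψ` is an integral ring map. -/
theorem isClosed_image_CΛ_chart_of_chart_iff [IsLocallyNoetherian Z] {ρ : Z ⟶ P 4 K} [IsSeparated ρ]
    [UniversallyClosed ρ]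
    {Ψ : A 4 K →+* A 4 K} (hc : φ ≫ ρ = Spec.map (CommRingCat.ofHom Ψ)) {Λ' : Set (Fin (4 + 1))}
    (hπ₂ : IsBlowup π₂ (vanishingIdeal (closureImage φ
      ((AffineCoordBlowup.𝓘Λ 4 K Λ').support : Set (P 4 K))))) {j' : Fin (4 + 1)} (hj' : j' ∈ Λ')
    (Θ' : A 4 K →+* A 4 K) [IsIso (CommRingCat.ofHom Θ')] (Λ'' : Set (Fin (4 + 1))) :
    IsClosed ((Spec.map (CommRingCat.ofHom Θ') ≫
        AffineCoordBlowup.chartImm (isBlowup_restrict_globalCentre φ _ hπ₂) hj' ≫ (π₂ ⁻¹ᵁ φ.opensRange).ι) ''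
      (AffineCoordBlowup.CΛ 4 K Λ'' : Set (P 4 K))) ↔
      ((Ideal.Quotient.mk (AffineCoordBlowup.IΛ 4 K Λ'')).comp
        ((Θ'.comp (coordBlowupSubst K Λ' j').toRingHom).comp Ψ)).IsIntegral := by
  haveI : IsProper π₂ := hπ₂.isProper
  haveI : IsSeparated (π₂ ≫ ρ) := inferInstance
  haveI : UniversallyClosed (π₂ ≫ ρ) :=
    MorphismProperty.IsStableUnderComposition.comp_mem _ _ inferInstance inferInstance
  exact isClosed_image_CΛ_iff_isIntegral _ (π₂ ≫ ρ) (chart_of_chart_comp_eq_specMap φ hc hπ₂ hj' Θ') Λ''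

end History

end ChartDictionary

end Summit.ResolutionOfSingularities.ResolutionOfSingularities.Theorems.PIDim4

end
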